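import Literature.MathematicalPhysics.QuantumManyBody.TorusBoseFockLayer
import Literature.MathematicalPhysics.QuantumManyBody.OneBodyCurrentGain
import Literature.MathematicalPhysics.QuantumManyBody.PeriodicBoseGasFracEnergy
import Mathlib.GroupTheory.Perm.Fin
import Mathlib.MeasureTheory.Integral.Prod
import HarnessLib

/-!
# The Fock layer of the torus in configuration space: `a(φ)`, `a†(φ)` on `N`-body wave functions

Topic `Literature/MathematicalPhysics/QuantumManyBody` (definition item `defn-TorusFockLayer`, wanted
by route BECRichardsonGaudin of `AtomisticToContinuum/BoseEinsteinCondensation`, cruxes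
`RichardsonAnchorBEC` (stmt-AtomisticToContinuum-14805, rank 3) and `BeliaevDeformationBound`
(rank 2)). Companion of `TorusBoseFockLayer.lean`, which already provides

* layer **A**, the bosonic Fock algebra over any set of modes in the holomorphic model
  (`Fock.cr`, `Fock.an`, CCR, `fockInner`, `Fock.pairAn`/`bandPairAn`, the `su(1,1)` generators
  `Fock.kPlus/kMinus/kZero` with `[K⁻,K⁺] = 2K⁰`, and the torus instance `TorusBoseFockLayer`);
* layer **B**, the torus of side `L` (`Momentum = ℤ³`, `waveVector`, the plane waves
  `planeWave L k = L^{-3/2} e^{2πi k·x/L} 1_cell`, `momentumOccupation`, the band `momentumBand M`,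
  its kernel `bandKernel` (`bandKernel_eq`: verbatim the route's `w`), the first-quantised band pair
  annihilation `bandPairAnnihilation` = `P_B`, and `pairFunctional_eq`);
* layer **C**, the expectations `Σ_k n_k = N`, `N - n₀ = Σ_{k≠0} n_k`, `∫|∇Ψ|² = Σ_k |k|² n_k`.

What the route's request adds, and this file supplies, is the **realisation of the single-mode
operators on configuration-space `N`-body functions** — the sector maps of
`𝓕(Λ) = ⊕_n L²(Λⁿ)` between which Richardson's `K⁺_k = a†_k a†_{-k}`, `P_Λ = Σ a_{-k}a_k` act — and the
dictionary lemmas in the literal form the route engraved: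

* `modeAn L φ` — **(A.13)**: `(a(φ)Ψ)(Y) = √N ∫_cell conj(φ(x)) Ψ(x, Y) dx`, an `(N-1)`-body function
  of an `N`-body `Ψ` (LSSY contract the last variable and write `√(N/V)∫Ψ e^{-ik·x_N}dx_N` for the
  `V`-normalised `e^{ikx}`; by Bose symmetry the slot is immaterial, and the tree's `occupation`,
  `bandPairAnnihilation` contract the first slot `Matrix.vecCons x Y`);
* `modeCr φ` — **(A.14)**: `(a†(φ)Φ)(X) = (N+1)^{-1/2} Σ_{j ≤ N} φ(x_j) Φ(X without x_j)`
  ("the sum is on `N+1` similar terms");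
* `TorusFockLayer := Π n, (Config n → ℂ)` — the configuration-space Fock layer
  `Ψ = (Ψ⁽ⁿ⁾)_{n ≥ 0}` [BastiCenatiempoSchlein2021, §1: `𝓕(Λ_L) = ⊕_{n≥0} L²_s(Λ_Lⁿ)`,
  `(𝒩ψ)⁽ⁿ⁾ = nψ⁽ⁿ⁾`] (algebraic direct product; square-summability is the finiteness of
  `TorusFockLayer.normSq`), with `TorusFockLayer.an/cr/number/vacuum/ofSector` acting degree-wise,
  so that a `PeriodicTrialState N L` is the Fock vector `ofSector N Ψ.ψ`.

## Main results

* **CCR** [LSSY2005, (A.7)]: `a(φ)a†(ψ)Ψ = ⟨φ,ψ⟩_cell Ψ + a†(ψ)a(φ)Ψ` *pointwise*, for every `Ψ` whose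
  slices are integrable against `φ` (`modeAn_modeCr_apply`, `modeAn_modeCr_config_zero`; graded form
  `TorusFockLayer.an_cr`); `[a(φ),a(ψ)] = 0` on Bose-symmetric continuous functions
  (`modeAn_modeAn_comm`, Fubini on `cell × cell`); `a(φ)|0⟩ = 0` (A.8) (`TorusFockLayer.an_vacuum`).
* **`a†(φ)` is the adjoint of `a(φ)`** on Bose-symmetric continuous functions:
  `∫_{Λ^{N+1}} conj(a†(φ)Φ) Ψ = ∫_{Λ^N} conj(Φ) a(φ)Ψ` (`integral_conj_modeCr_mul`, and its conjugate
  `integral_conj_modeAn_mul`) — the change of variables `X ↦ (x_j, X̂_j)` at each slot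
  (`measurePreserving_piFinSuccAbove_cellN`) and `Ψ(insertNth j x Y) = Ψ(x :: Y)` by symmetry.
* **Dictionary (i)** [LSSY2005, (A.11), (A.13); §1.2 (1.17)]:
  `cellOccupation (n+1) L φ Ψ = ∫_{Λⁿ} |a(φ)Ψ|² = ⟨Ψ, a†(φ)a(φ)Ψ⟩` for *every* mode and wave function
  (`cellOccupation_eq_lintegral_modeAn`); in particular `momentumOccupation = ‖a_kΨ‖²`,
  `condensateOccupation = ‖a_0Ψ‖²` (`…_eq_lintegral_modeAn`), `Σ_k ‖a_kΨ‖² = N`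
  (`tsum_lintegral_modeAn_planeWave_trialState`) and the depletion
  `N - n₀ = Σ_{k≠0} ‖a_kΨ‖²` (`natCast_sub_condensateOccupation_eq_tsum_modeAn`).
* **Dictionary (ii)** [LSSY2005, (A.13) twice]: `a(φ)a(ψ)Ψ = √(N(N-1)) ∫∫ conj(φ(y)ψ(x)) Ψ(x,y,·)`
  (`modeAn_modeAn_apply`); `P_B Ψ = Σ_{k∈B} a_{-k}(a_k Ψ)` (`bandPairAnnihilation_eq_sum_modeAn`,
  Fubini); and, for the band `B_M = {-M..M}³` with kernel `w = bandKernel L M`,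
  `‖P_{B_M}Ψ‖² = ‖Σ_{k∈B_M} a_{-k}a_kΨ‖² = N(N-1) L⁻⁶ ∫_{Λ^{N-2}} |∫_Λ∫_Λ conj(w(x,y)) Ψ(x,y,Y) dx dy|² dY`
  (`lintegral_bandPairAnnihilation_sq`, `lintegral_sum_modeAn_modeAn_sq`) — the route's pair term
  `(γ/L⁹)(N(N-1)/2)∫|∫∫conj(w)Ψ|²` is `(γ/2L³)⟨Ψ, P†_ΛP_ΛΨ⟩`, `g = 2γ/V` in Richardson's units.
* **Dictionary (iii)** [LSSY2005, (A.6), (A.10)]: `periodicEnergy 0 Ψ = ∫_{Λ^N}|∇Ψ|² = Σ_k |k|² ‖a_kΨ‖²`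
  for periodic `C¹` Bose-symmetric states (`periodicEnergy_zero_eq_tsum_modeAn`,
  `lintegral_kineticDensity_eq_tsum_modeAn`; Parseval on the torus, from layer C).

## Design choices

* Modes `φ` are arbitrary functions `ℝ³ → ℂ` and all integrals are over the fundamental cell
  `cell L = [0,L)³` / `cellN n L`, exactly as `cellOccupation`, `bandPairAnnihilation`; the plane waves
  `planeWave L k` carry their own cell indicator. Analytic identities are stated under the minimal
  honest hypotheses: integrability of the slices for the CCR, and "bounded measurable mode +
  continuous wave function (+ Bose symmetry)" for Fubini/adjointness (`PeriodicTrialState`s are `C¹`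
  and symmetric; `planeWave` is bounded by `L^{-3/2}` (`norm_planeWave_le`) and measurable
  (`measurable_planeWave`)).
* `ℂ`-valued Bochner integrals for the operators, `ℝ≥0∞` lower integrals for the quadratic
  expectations, matching `PeriodicBoseGas.lean`.
* The `su(1,1)` relations themselves are layer A (`Fock.kMinus_kPlus_sub` …) and are not re-proved on
  configuration space; here `K⁻_k ∝ a_{-k}a_k` is `modeAn L (planeWave L (-k)) ∘ modeAn L (planeWave L k)`
  (`modeAn_modeAn_apply`) and `K⁺_k` its adjoint by `integral_conj_modeCr_mul` twice.
* Mathlib has no Fock space / second quantisation (searched `Fock`, `CCR`, `annihilation`,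
  `creation operator`: nothing beyond `CliffordAlgebra`); `Fin.removeNth`/`insertNth`,
  `Fin.cons_comp_cycleRange`, `MeasurableEquiv.piFinSuccAbove`, `integral_prod_symm`,
  `integral_integral_swap`, `Integrable.bdd_mul` are Mathlib's.

## What is deliberately NOT here

* The `L²` closure and the unbounded-operator theory of `a(φ)`, `a†(φ)` (domains, closability, the
  `√𝒩` bounds): the identities are stated on the continuous / slice-integrable functions the routes use.
* The Bose symmetriser and the restriction to `L²_s`: `modeCr φ Φ` is symmetric when `Φ` is, but this
  is not needed by the dictionary and is left out; symmetry enters only as a hypothesis (`hsymm`).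
* `H_R`, `H_N` as operators on `TorusFockLayer` ((A.10) as a map) and Richardson's Bethe equations —
  layer-2 material of the route; the interaction dictionary for finite-mode sectors is
  `TorusFockSectorInteraction.lean`.

## References

* [LSSY2005] E. H. Lieb, R. Seiringer, J. P. Solovej, J. Yngvason, *The Mathematics of the Bose Gas and
  its Condensation*, Oberwolfach Seminars 34, Birkhäuser 2005 (arXiv:cond-mat/0610117, p. 98 of the
  arXiv text), Appendix A "Elements of Bogoliubov Theory": (A.7) CCR, (A.8) vacuum, (A.9) the
  isomorphism, (A.10) `H`, (A.11) number operator, (A.13) `a_kΨ ↔ √(N/V)∫_V Ψ e^{-ik·x_N}d³x_N`,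
  (A.14) `a†_kΨ ↔ ((N+1)V)^{-1/2} Σ e^{ik·x_{N+1}}Ψ`; §1.2 (1.17) (`⟨φ, γφ⟩`).
* [BastiCenatiempoSchlein2021] G. Basti, S. Cenatiempo, B. Schlein, *A new second-order upper bound for
  the ground state energy of dilute Bose gases*, Forum Math. Sigma 9 (2021) e74 (arXiv:2101.06222):
  §1 (`𝓕(Λ_L) = ⊕_{n≥0} L²_s(Λ_Lⁿ)`, `(𝒩ψ)⁽ⁿ⁾ = nψ⁽ⁿ⁾`), §2 (2.1) (CCR for `a_p, a_p^*`).
* [Fournais2020] S. Fournais, *Length scales for BEC in the dilute Bose gas*, arXiv:2011.00309: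
  (1.3)–(1.5) (`n₀`, `n₊ = N - n₀`).
* [DukelskySchuck2001] J. Dukelsky, P. Schuck, Phys. Rev. Lett. 86 (2001) 4207, eq. (1)
  (`H_P = Σ ε n + (g/2) Σ A†A`, `A = Σ a a`) — the pairing form served by (ii).
* Tree: `TorusBoseFockLayer.lean` (layers A–C), `PeriodicBoseGasFracEnergy.lean`
  (`cellOccupation_succ`), `OneBodyCurrentGain.lean` (`measurePreserving_piFinSuccAbove_cellN`),
  `WeightedCorrector.lean` (`integrableOn_cellN`, `cellN_subset_closedBall`),
  `PeriodicBoseGasFourier.lean` (`integrableOn_cell`, `cell_subset_closedBox`).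
-/

noncomputable section

namespace Literature.MathematicalPhysics.QuantumManyBody.BoseGas

open _root_.MeasureTheory _root_.Complex
open scoped ENNReal NNReal ComplexConjugate

/-! ### Tuple bookkeeping: removing and inserting a particle -/

section Tuples

variable {α : Type*} {m : ℕ}

/-- Removing the head of `x :: v` gives `v`. [folklore] -/
theorem removeNth_zero_vecCons (w : α) (v : Fin m → α) :
    Fin.removeNth 0 (Matrix.vecCons w v) = v := by
  ext i
  simp [Fin.removeNth]

/-- Removing entry `i+1` of `x :: v` is `x ::` (removing entry `i` of `v`). [folklore] -/
theorem removeNth_succ_vecCons (w : α) (v : Fin (m + 1) → α) (i : Fin (m + 1)) :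
    Fin.removeNth i.succ (Matrix.vecCons w v) = Matrix.vecCons w (Fin.removeNth i v) := by
  ext j
  refine Fin.cases ?_ (fun j' => ?_) j
  · simp [Fin.removeNth]
  · simp [Fin.removeNth, Fin.succ_succAbove_succ]

/-- Swapping the first two particles: `(x :: y :: v) ∘ (0 1) = y :: x :: v`. [folklore] -/
theorem vecCons_vecCons_comp_swap (w w' : α) (v : Fin m → α) :
    Matrix.vecCons w (Matrix.vecCons w' v) ∘ Equiv.swap (0 : Fin (m + 2)) 1 =
      Matrix.vecCons w' (Matrix.vecCons w v) := by
  ext i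
  refine Fin.cases ?_ (fun i' => Fin.cases ?_ (fun i'' => ?_) i') i
  · simp
  · simp
  · have h0 : (i''.succ.succ : Fin (m + 2)) ≠ 0 := Fin.succ_ne_zero _
    have h1 : (i''.succ.succ : Fin (m + 2)) ≠ 1 := by
      rw [ne_eq, show (1 : Fin (m + 2)) = (0 : Fin (m + 1)).succ from rfl, Fin.succ_inj]
      exact Fin.succ_ne_zero _
    simp [Equiv.swap_apply_of_ne_of_ne h0 h1]

/-- Moving particle `j` to the front is a permutation of the particles:
`(x_j :: X̂_j) ∘ cycleRange j = X` (Mathlib's `Fin.cons_comp_cycleRange`). [folklore] -/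
theorem vecCons_self_removeNth_comp_cycleRange (j : Fin (m + 1)) (X : Fin (m + 1) → α) :
    Matrix.vecCons (X j) (j.removeNth X) ∘ j.cycleRange = X := by
  rw [Matrix.vecCons, Fin.cons_comp_cycleRange, Fin.insertNth_self_removeNth]

/-- Dropping a particle is continuous. [folklore] -/
theorem continuous_removeNth (j : Fin (m + 1)) : Continuous fun X : Config (m + 1) => j.removeNth X :=
  continuous_pi fun _ => continuous_apply _

end Tuples

/-! ### Integrability bookkeeping on the (bounded) fundamental cells -/

section Integrability

/-- A continuous function is integrable on a bounded set, for a measure finite on compacts. [folklore] -/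
theorem integrableOn_of_continuous_of_isBounded {E F : Type*} [MetricSpace E] [ProperSpace E]
    [MeasurableSpace E] [OpensMeasurableSpace E] [NormedAddCommGroup F] {μ : Measure E}
    [IsFiniteMeasureOnCompacts μ] {s : Set E} (hs : Bornology.IsBounded s) {f : E → F}
    (hf : Continuous f) : IntegrableOn f s μ :=
  (hf.continuousOn.integrableOn_compact hs.isCompact_closure).mono_set subset_closure

/-- The cell is bounded (cf. `cell_subset_closedBox`). [folklore] -/
private theorem isBounded_cell_aux (L : ℝ) : Bornology.IsBounded (cell L) :=
  (isCompact_closedBox L).isBounded.subset (cell_subset_closedBox L)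

/-- `Λⁿ = [0,L)^{3n}` is bounded. [folklore] -/
theorem isBounded_cellN (N : ℕ) (L : ℝ) : Bornology.IsBounded (cellN N L) :=
  Metric.isBounded_closedBall.subset (cellN_subset_closedBall N L)

/-- The plane waves are measurable. [folklore] -/
theorem measurable_planeWave (L : ℝ) (k : Momentum) : Measurable (planeWave L k) :=
  (measurable_const.mul (continuous_cellWave L k).measurable).indicator (measurableSet_cell L)

variable {L : ℝ}

/-- A bounded measurable mode against a continuous slice is integrable on the cell. [folklore] -/
theorem integrableOn_cell_conj_mul {φ : Space → ℂ} (hφ : Measurable φ) {C : ℝ} (hC : ∀ x, ‖φ x‖ ≤ C)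
    {f : Space → ℂ} (hf : Continuous f) :
    IntegrableOn (fun x => conj (φ x) * f x) (cell L) := by
  refine Integrable.bdd_mul (c := C) (integrableOn_cell hf)
    (show AEStronglyMeasurable (fun x => conj (φ x)) _ from
      (Complex.continuous_conj.measurable.comp hφ).aestronglyMeasurable)
    (Filter.Eventually.of_forall fun x => ?_)
  rw [Complex.norm_conj]
  exact hC x

/-- Joint integrability on `cell × cell` of two bounded measurable modes against the two-particle
slices of a continuous `(n+2)`-body function (the Fubini hypothesis for `a(φ)a(ψ)`). [folklore] -/
theorem integrable_cell_prod_cell {φ ψ : Space → ℂ} (hφ : Measurable φ) (hψ : Measurable ψ)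
    {Cφ Cψ : ℝ} (hCφ : ∀ x, ‖φ x‖ ≤ Cφ) (hCψ : ∀ x, ‖ψ x‖ ≤ Cψ) {n : ℕ} {Ψ : Config (n + 2) → ℂ}
    (hΨ : Continuous Ψ) (Y : Config n) :
    Integrable (fun p : Space × Space =>
        conj (ψ p.1) * conj (φ p.2) * Ψ (Matrix.vecCons p.1 (Matrix.vecCons p.2 Y)))
      (((volume : Measure Space).restrict (cell L)).prod
        ((volume : Measure Space).restrict (cell L))) := by
  rw [Measure.prod_restrict]
  have hc : Continuous fun p : Space × Space => Ψ (Matrix.vecCons p.1 (Matrix.vecCons p.2 Y)) :=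
    hΨ.comp (continuous_fst.matrixVecCons (continuous_snd.matrixVecCons continuous_const))
  have hG : IntegrableOn (fun p : Space × Space => Ψ (Matrix.vecCons p.1 (Matrix.vecCons p.2 Y)))
      (cell L ×ˢ cell L) ((volume : Measure Space).prod volume) :=
    integrableOn_of_continuous_of_isBounded ((isBounded_cell_aux L).prod (isBounded_cell_aux L)) hc
  have h1 := hG.bdd_mul (c := Cφ)
    (show AEStronglyMeasurable (fun p : Space × Space => conj (φ p.2)) _ from
      (Complex.continuous_conj.measurable.comp (hφ.comp measurable_snd)).aestronglyMeasurable)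
    (Filter.Eventually.of_forall fun p => by rw [Complex.norm_conj]; exact hCφ p.2)
  have h2 := h1.bdd_mul (c := Cψ)
    (show AEStronglyMeasurable (fun p : Space × Space => conj (ψ p.1)) _ from
      (Complex.continuous_conj.measurable.comp (hψ.comp measurable_fst)).aestronglyMeasurable)
    (Filter.Eventually.of_forall fun p => by rw [Complex.norm_conj]; exact hCψ p.1)
  simpa only [mul_assoc] using h2

/-- Joint integrability on `cell × cellⁿ` of a bounded measurable mode and a continuous `n`-body
function against a continuous `(n+1)`-body function (the Fubini hypothesis for adjointness).
[folklore] -/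
theorem integrable_cell_prod_cellN {φ : Space → ℂ} (hφ : Measurable φ) {C : ℝ} (hC : ∀ x, ‖φ x‖ ≤ C)
    {n : ℕ} {Φ : Config n → ℂ} (hΦ : Continuous Φ) {Ψ : Config (n + 1) → ℂ} (hΨ : Continuous Ψ) :
    Integrable (fun p : Space × Config n => conj (φ p.1) * conj (Φ p.2) * Ψ (Matrix.vecCons p.1 p.2))
      (((volume : Measure Space).restrict (cell L)).prod
        ((volume : Measure (Config n)).restrict (cellN n L))) := by
  rw [Measure.prod_restrict]
  have hc : Continuous fun p : Space × Config n => conj (Φ p.2) * Ψ (Matrix.vecCons p.1 p.2) :=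
    (Complex.continuous_conj.comp (hΦ.comp continuous_snd)).mul
      (hΨ.comp (continuous_fst.matrixVecCons continuous_snd))
  have hG : IntegrableOn (fun p : Space × Config n => conj (Φ p.2) * Ψ (Matrix.vecCons p.1 p.2))
      (cell L ×ˢ cellN n L) ((volume : Measure Space).prod volume) :=
    integrableOn_of_continuous_of_isBounded ((isBounded_cell_aux L).prod (isBounded_cellN n L)) hc
  have h1 := hG.bdd_mul (c := C)
    (show AEStronglyMeasurable (fun p : Space × Config n => conj (φ p.1)) _ from
      (Complex.continuous_conj.measurable.comp (hφ.comp measurable_fst)).aestronglyMeasurable)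
    (Filter.Eventually.of_forall fun p => by rw [Complex.norm_conj]; exact hC p.1)
  simpa only [mul_assoc] using h1

end Integrability

/-! ### `a(φ)` and `a†(φ)` on configuration-space `N`-body functions -/

/-- **The annihilation operator of the mode `φ` in first quantisation** [LSSY (A.13)]: for an
`N = n+1`-body wave function `Ψ` on the cell, the `n`-body function
`(a(φ)Ψ)(Y) = √N ∫_cell conj(φ(x)) Ψ(x, Y) dx`
(LSSY: `a_kΨ ↔ √(N/V) ∫_V Ψ(x_1,…,x_N) e^{-ik·x_N} d³x_N`, i.e. `√N ∫ conj(φ_k(x_N)) Ψ dx_N` for the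
normalised plane wave `φ_k = V^{-1/2}e^{ik·x}`; the contracted slot is immaterial for Bose-symmetric
`Ψ`, and we contract the first one, `Matrix.vecCons x Y`, as `occupation`/`bandPairAnnihilation` do).
[cite: LSSY2005, App. A (A.13)] -/
def modeAn (L : ℝ) (φ : Space → ℂ) {n : ℕ} (Ψ : Config (n + 1) → ℂ) (Y : Config n) : ℂ :=
  ((Real.sqrt (n + 1) : ℝ) : ℂ) * ∫ x in cell L, conj (φ x) * Ψ (Matrix.vecCons x Y)

/-- **The creation operator of the mode `φ` in first quantisation** [LSSY (A.14)]: for an `n`-body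
wave function `Φ`, the `(n+1)`-body function
`(a†(φ)Φ)(x_0,…,x_n) = (n+1)^{-1/2} Σ_{j=0}^{n} φ(x_j) Φ(x_0,…,x̂_j,…,x_n)`
("`a†_kΨ ↔ ((N+1)V)^{-1/2} Σ e^{ik·x_{N+1}} Ψ(x_1,…,x_N)`, where the sum is on `N+1` similar terms").
[cite: LSSY2005, App. A (A.14)] -/
def modeCr (φ : Space → ℂ) {n : ℕ} (Φ : Config n → ℂ) (X : Config (n + 1)) : ℂ :=
  ((Real.sqrt (n + 1) : ℝ) : ℂ)⁻¹ * ∑ j : Fin (n + 1), φ (X j) * Φ (j.removeNth X)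

section Basic

variable (L : ℝ) (φ : Space → ℂ) {n : ℕ}

/-- Unfolding `a(φ)`. [cite: LSSY2005, App. A (A.13)] -/
theorem modeAn_apply (Ψ : Config (n + 1) → ℂ) (Y : Config n) :
    modeAn L φ Ψ Y =
      ((Real.sqrt (n + 1) : ℝ) : ℂ) * ∫ x in cell L, conj (φ x) * Ψ (Matrix.vecCons x Y) :=
  rfl

/-- Unfolding `a†(φ)`. [cite: LSSY2005, App. A (A.14)] -/
theorem modeCr_apply (Φ : Config n → ℂ) (X : Config (n + 1)) :
    modeCr φ Φ X =
      ((Real.sqrt (n + 1) : ℝ) : ℂ)⁻¹ * ∑ j : Fin (n + 1), φ (X j) * Φ (j.removeNth X) :=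
  rfl

/-- `a(φ) 0 = 0`. [folklore] -/
@[simp] theorem modeAn_zero : modeAn L φ (0 : Config (n + 1) → ℂ) = 0 := by
  funext Y; simp [modeAn]

/-- `a†(φ) 0 = 0`. [folklore] -/
@[simp] theorem modeCr_zero : modeCr φ (0 : Config n → ℂ) = 0 := by
  funext X; simp [modeCr]

/-- `a(φ)` is additive on functions with integrable slices. [folklore] -/
theorem modeAn_add (Ψ₁ Ψ₂ : Config (n + 1) → ℂ)
    (h₁ : ∀ Y, IntegrableOn (fun x => conj (φ x) * Ψ₁ (Matrix.vecCons x Y)) (cell L))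
    (h₂ : ∀ Y, IntegrableOn (fun x => conj (φ x) * Ψ₂ (Matrix.vecCons x Y)) (cell L)) :
    modeAn L φ (Ψ₁ + Ψ₂) = modeAn L φ Ψ₁ + modeAn L φ Ψ₂ := by
  funext Y
  simp only [modeAn, Pi.add_apply, mul_add]
  rw [integral_add (h₁ Y) (h₂ Y), mul_add]

/-- `a(φ)` is homogeneous. [folklore] -/
theorem modeAn_smul (c : ℂ) (Ψ : Config (n + 1) → ℂ) :
    modeAn L φ (c • Ψ) = c • modeAn L φ Ψ := by
  funext Y
  simp only [modeAn, Pi.smul_apply, smul_eq_mul]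
  have : (fun x => conj (φ x) * (c * Ψ (Matrix.vecCons x Y))) =
      fun x => c * (conj (φ x) * Ψ (Matrix.vecCons x Y)) := by
    funext x; ring
  rw [this, integral_const_mul]
  ring

/-- `a†(φ)` is additive. [folklore] -/
theorem modeCr_add (Φ₁ Φ₂ : Config n → ℂ) : modeCr φ (Φ₁ + Φ₂) = modeCr φ Φ₁ + modeCr φ Φ₂ := by
  funext X
  simp only [modeCr, Pi.add_apply, mul_add, Finset.sum_add_distrib]

/-- `a†(φ)` is homogeneous. [folklore] -/
theorem modeCr_smul (c : ℂ) (Φ : Config n → ℂ) : modeCr φ (c • Φ) = c • modeCr φ Φ := by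
  funext X
  simp only [modeCr, Pi.smul_apply, smul_eq_mul, Finset.mul_sum]
  refine Finset.sum_congr rfl fun j _ => ?_
  ring

/-- **`a†(φ)|0⟩ = φ`**: on the vacuum sector (constants `Φ : Config 0 → ℂ`), `a†(φ)Φ = φ(x_0) Φ`.
[cite: LSSY2005, App. A (A.9), (A.14)] -/
theorem modeCr_config_zero (Φ : Config 0 → ℂ) (X : Config 1) :
    modeCr φ Φ X = φ (X 0) * Φ Fin.elim0 := by
  rw [modeCr, Fin.sum_univ_one, show (0 : Fin 1).removeNth X = Fin.elim0 from Subsingleton.elim _ _]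
  simp

/-- `a†(φ)Φ` through the first slot:
`(a†(φ)Φ)(x, Y) = (n+2)^{-1/2} (φ(x) Φ(Y) + Σᵢ φ(yᵢ) Φ(x, Ŷᵢ))` for an `(n+1)`-body `Φ`.
[cite: LSSY2005, App. A (A.14)] -/
theorem modeCr_vecCons (Φ : Config (n + 1) → ℂ) (x : Space) (Y : Config (n + 1)) :
    modeCr φ Φ (Matrix.vecCons x Y) = ((Real.sqrt (n + 2) : ℝ) : ℂ)⁻¹ *
      (φ x * Φ Y + ∑ i : Fin (n + 1), φ (Y i) * Φ (Matrix.vecCons x (i.removeNth Y))) := by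
  rw [modeCr, Fin.sum_univ_succ]
  simp only [Matrix.cons_val_zero, Matrix.cons_val_succ, removeNth_zero_vecCons,
    removeNth_succ_vecCons]
  push_cast
  ring_nf

/-- `√(n+1) ≠ 0` in `ℂ`. [folklore] -/
theorem sqrt_cast_ne_zero (n : ℕ) : ((Real.sqrt (n + 1) : ℝ) : ℂ) ≠ 0 := by
  rw [Ne, Complex.ofReal_eq_zero]
  exact (Real.sqrt_pos.mpr (by positivity)).ne'

end Basic

/-! ### The canonical commutation relations in first quantisation -/

section CCR

variable {L : ℝ} {φ ψ : Space → ℂ} {n : ℕ}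

/-- **Two annihilations** [(A.13) twice]: for an `N = n+2`-body `Ψ`,
`(a(φ)a(ψ)Ψ)(Y) = √(N(N-1)) ∫_cell∫_cell conj(φ(y)) conj(ψ(x)) Ψ(x, y, Y) dx dy`
(`a(ψ)` contracts the first slot, then `a(φ)` the new first slot; no hypotheses).
[cite: LSSY2005, App. A (A.13)] -/
theorem modeAn_modeAn_apply (L : ℝ) (φ ψ : Space → ℂ) (Ψ : Config (n + 2) → ℂ) (Y : Config n) :
    modeAn L φ (modeAn L ψ Ψ) Y = ((Real.sqrt ((n + 2) * (n + 1)) : ℝ) : ℂ) *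
      ∫ y in cell L, ∫ x in cell L,
        conj (φ y) * conj (ψ x) * Ψ (Matrix.vecCons x (Matrix.vecCons y Y)) := by
  rw [modeAn_apply]
  simp only [modeAn_apply]
  have h : ∀ y : Space, conj (φ y) * (((Real.sqrt (↑(n + 1) + 1) : ℝ) : ℂ) *
      ∫ x in cell L, conj (ψ x) * Ψ (Matrix.vecCons x (Matrix.vecCons y Y))) =
      ((Real.sqrt (n + 2) : ℝ) : ℂ) * ∫ x in cell L,
        conj (φ y) * conj (ψ x) * Ψ (Matrix.vecCons x (Matrix.vecCons y Y)) := by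
    intro y
    rw [← integral_const_mul, ← integral_const_mul, ← integral_const_mul]
    refine integral_congr_ae (Filter.Eventually.of_forall fun x => ?_)
    push_cast
    ring_nf
  simp only [h]
  rw [integral_const_mul, ← mul_assoc, ← Complex.ofReal_mul, ← Real.sqrt_mul (by positivity)]
  ring_nf

/-- **CCR `[a(φ), a†(ψ)] = ⟨φ, ψ⟩`** [(A.7)] on the sectors `N ≥ 1`, pointwise and exactly:
`a(φ)(a†(ψ)Ψ)(Y) = (∫_cell conj(φ)ψ) Ψ(Y) + a†(ψ)(a(φ)Ψ)(Y)` for every `(n+1)`-body `Ψ` whose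
first-slot slices are integrable against `conj φ` on the cell and every `Y` (the `j = 0` term of
(A.14) meets the contraction (A.13); the `j ≥ 1` terms commute through).
[cite: LSSY2005, App. A (A.7), (A.13), (A.14)] -/
theorem modeAn_modeCr_apply {Ψ : Config (n + 1) → ℂ}
    (hφψ : IntegrableOn (fun x => conj (φ x) * ψ x) (cell L))
    (hΨ : ∀ Z : Config n, IntegrableOn (fun x => conj (φ x) * Ψ (Matrix.vecCons x Z)) (cell L))
    (Y : Config (n + 1)) :
    modeAn L φ (modeCr ψ Ψ) Y =
      (∫ x in cell L, conj (φ x) * ψ x) * Ψ Y + modeCr ψ (modeAn L φ Ψ) Y := by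
  have hc1 := sqrt_cast_ne_zero n
  -- the integrand of the left-hand side
  have hpt : ∀ x : Space, conj (φ x) * modeCr ψ Ψ (Matrix.vecCons x Y) =
      ((Real.sqrt (n + 2) : ℝ) : ℂ)⁻¹ * (conj (φ x) * ψ x * Ψ Y +
        ∑ i : Fin (n + 1), ψ (Y i) * (conj (φ x) * Ψ (Matrix.vecCons x (i.removeNth Y)))) := by
    intro x
    rw [modeCr_vecCons]
    have : conj (φ x) * ∑ i : Fin (n + 1), ψ (Y i) * Ψ (Matrix.vecCons x (i.removeNth Y)) =
        ∑ i : Fin (n + 1), ψ (Y i) * (conj (φ x) * Ψ (Matrix.vecCons x (i.removeNth Y))) := by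
      rw [Finset.mul_sum]
      exact Finset.sum_congr rfl fun i _ => by ring
    rw [← this]
    ring
  have hint : ∀ i : Fin (n + 1), Integrable
      (fun x => ψ (Y i) * (conj (φ x) * Ψ (Matrix.vecCons x (i.removeNth Y))))
      ((volume : Measure Space).restrict (cell L)) := fun i => (hΨ _).const_mul _
  rw [modeAn_apply]
  simp only [hpt]
  rw [integral_const_mul, integral_add (hφψ.mul_const _) (integrable_finsetSum _ fun i _ => hint i),
    integral_finsetSum _ (fun i _ => hint i), integral_mul_const]
  simp only [integral_const_mul]
  -- the right-hand side
  rw [modeCr_apply]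
  simp only [modeAn_apply]
  have h2 : ((Real.sqrt (↑(n + 1) + 1) : ℝ) : ℂ) = ((Real.sqrt (n + 2) : ℝ) : ℂ) := by
    push_cast; ring_nf
  have hc2 : ((Real.sqrt (n + 2) : ℝ) : ℂ) ≠ 0 := by
    rw [Ne, Complex.ofReal_eq_zero]
    exact (Real.sqrt_pos.mpr (by positivity)).ne'
  rw [h2, ← mul_assoc, mul_inv_cancel₀ hc2, one_mul, Finset.mul_sum]
  congr 1
  refine Finset.sum_congr rfl fun i _ => ?_
  field_simp

/-- **CCR on the vacuum sector**: for a `0`-body `Ψ` (a constant), `a(φ)(a†(ψ)Ψ) = ⟨φ,ψ⟩_cell Ψ`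
(and `a†(ψ)a(φ)Ψ = 0` as there is no `(-1)`-sector). [cite: LSSY2005, App. A (A.7), (A.8)] -/
theorem modeAn_modeCr_config_zero (L : ℝ) (φ ψ : Space → ℂ) (Ψ : Config 0 → ℂ) (Y : Config 0) :
    modeAn L φ (modeCr ψ Ψ) Y = (∫ x in cell L, conj (φ x) * ψ x) * Ψ Y := by
  rw [modeAn_apply]
  simp only [modeCr_config_zero, Matrix.cons_val_zero]
  rw [show (Fin.elim0 : Config 0) = Y from Subsingleton.elim _ _]
  simp only [← mul_assoc, integral_mul_const]
  simp

/-- **`[a(φ), a(ψ)] = 0`** [(A.7)] on Bose-symmetric continuous `(n+2)`-body functions, for bounded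
measurable modes (Fubini on `cell × cell` and the transposition of the two contracted slots).
[cite: LSSY2005, App. A (A.7), (A.13)] -/
theorem modeAn_modeAn_comm (hφ : Measurable φ) (hψ : Measurable ψ) {Cφ Cψ : ℝ}
    (hCφ : ∀ x, ‖φ x‖ ≤ Cφ) (hCψ : ∀ x, ‖ψ x‖ ≤ Cψ) {Ψ : Config (n + 2) → ℂ} (hΨ : Continuous Ψ)
    (hsymm : ∀ (σ : Equiv.Perm (Fin (n + 2))) (X : Config (n + 2)), Ψ (X ∘ σ) = Ψ X) :
    modeAn L φ (modeAn L ψ Ψ) = modeAn L ψ (modeAn L φ Ψ) := by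
  funext Y
  rw [modeAn_modeAn_apply, modeAn_modeAn_apply]
  congr 1
  have hint := integrable_cell_prod_cell (L := L) hφ hψ hCφ hCψ hΨ Y
  rw [← integral_integral_swap (hint.congr (Filter.Eventually.of_forall fun p => by
    dsimp only [Function.uncurry]; ring))]
  refine integral_congr_ae (Filter.Eventually.of_forall fun x => ?_)
  refine integral_congr_ae (Filter.Eventually.of_forall fun y => ?_)
  simp only
  rw [← hsymm (Equiv.swap 0 1) (Matrix.vecCons x (Matrix.vecCons y Y)), vecCons_vecCons_comp_swap]
  ring

end CCR

/-! ### `a†(φ)` is the adjoint of `a(φ)` -/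

section Adjoint

variable {L : ℝ} {φ : Space → ℂ} {n : ℕ}

/-- **`a†(φ) = a(φ)†` on `L²(Λⁿ) → L²(Λⁿ⁺¹)`**: for a bounded measurable mode `φ`, a continuous
`n`-body `Φ` and a continuous Bose-symmetric `(n+1)`-body `Ψ`,
`∫_{Λⁿ⁺¹} conj(a†(φ)Φ) Ψ = ∫_{Λⁿ} conj(Φ) a(φ)Ψ` (LSSY: `a_k` is "the Hermitian conjugate" of `a†_k`;
each of the `n+1` terms of (A.14) contributes `∫_{Λⁿ} conj Φ(Y) ∫_Λ conj φ(x) Ψ(x,Y)` after the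
measure-preserving split `X ↦ (x_j, X̂_j)` and `Ψ(insertNth j x Y) = Ψ(x :: Y)`).
[cite: LSSY2005, App. A (A.13)–(A.14)] -/
theorem integral_conj_modeCr_mul (hφ : Measurable φ) {C : ℝ} (hC : ∀ x, ‖φ x‖ ≤ C)
    {Φ : Config n → ℂ} (hΦ : Continuous Φ) {Ψ : Config (n + 1) → ℂ} (hΨ : Continuous Ψ)
    (hsymm : ∀ (σ : Equiv.Perm (Fin (n + 1))) (X : Config (n + 1)), Ψ (X ∘ σ) = Ψ X) :
    ∫ X in cellN (n + 1) L, conj (modeCr φ Φ X) * Ψ X =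
      ∫ Y in cellN n L, conj (Φ Y) * modeAn L φ Ψ Y := by
  set T : ℂ := ∫ Y in cellN n L, conj (Φ Y) * ∫ x in cell L, conj (φ x) * Ψ (Matrix.vecCons x Y)
    with hT
  set g : Space × Config n → ℂ := fun p =>
    conj (φ p.1) * conj (Φ p.2) * Ψ (Matrix.vecCons p.1 p.2) with hg
  -- each of the `n+1` terms of `a†(φ)Φ` contributes `T`
  have hterm : ∀ j : Fin (n + 1),
      ∫ X in cellN (n + 1) L, conj (φ (X j)) * conj (Φ (j.removeNth X)) * Ψ X = T := by
    intro j
    have he := measurePreserving_piFinSuccAbove_cellN (n := n) j L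
    have h1 : ∀ X : Config (n + 1), conj (φ (X j)) * conj (Φ (j.removeNth X)) * Ψ X =
        g (MeasurableEquiv.piFinSuccAbove (fun _ : Fin (n + 1) => Space) j X) := by
      intro X
      change _ = conj (φ (X j)) * conj (Φ (j.removeNth X)) * Ψ (Matrix.vecCons (X j) (j.removeNth X))
      rw [← hsymm j.cycleRange (Matrix.vecCons (X j) (j.removeNth X)),
        vecCons_self_removeNth_comp_cycleRange]
    simp_rw [h1]
    rw [he.integral_comp' g, integral_prod_symm g (integrable_cell_prod_cellN hφ hC hΦ hΨ)]
    refine integral_congr_ae (Filter.Eventually.of_forall fun Y => ?_)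
    dsimp only
    rw [← integral_const_mul]
    refine integral_congr_ae (Filter.Eventually.of_forall fun x => ?_)
    simp only [hg]
    ring
  -- integrability of the terms
  have hint : ∀ j : Fin (n + 1), Integrable
      (fun X : Config (n + 1) => conj (φ (X j)) * conj (Φ (j.removeNth X)) * Ψ X)
      ((volume : Measure (Config (n + 1))).restrict (cellN (n + 1) L)) := by
    intro j
    have hc : Continuous fun X : Config (n + 1) => conj (Φ (j.removeNth X)) * Ψ X :=
      (Complex.continuous_conj.comp (hΦ.comp (continuous_removeNth j))).mul hΨ
    have h := (integrableOn_cellN hc L).bdd_mul (c := C)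
      (show AEStronglyMeasurable (fun X : Config (n + 1) => conj (φ (X j))) _ from
        (Complex.continuous_conj.measurable.comp
          (hφ.comp (measurable_pi_apply j))).aestronglyMeasurable)
      (Filter.Eventually.of_forall fun X => by rw [Complex.norm_conj]; exact hC (X j))
    simpa only [mul_assoc] using h
  -- expand the left-hand side
  have hpt : ∀ X : Config (n + 1), conj (modeCr φ Φ X) * Ψ X = ∑ j : Fin (n + 1),
      ((Real.sqrt (n + 1) : ℝ) : ℂ)⁻¹ * (conj (φ (X j)) * conj (Φ (j.removeNth X)) * Ψ X) := by
    intro X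
    rw [modeCr_apply, map_mul, map_inv₀, Complex.conj_ofReal, map_sum, Finset.mul_sum,
      Finset.sum_mul]
    refine Finset.sum_congr rfl fun j _ => ?_
    rw [map_mul]
    ring
  simp_rw [hpt]
  rw [integral_finsetSum _ fun j _ => (hint j).const_mul _]
  simp only [integral_const_mul, hterm, Finset.sum_const, Finset.card_univ, Fintype.card_fin,
    nsmul_eq_mul]
  -- the right-hand side
  have hrhs : ∫ Y in cellN n L, conj (Φ Y) * modeAn L φ Ψ Y =
      ((Real.sqrt (n + 1) : ℝ) : ℂ) * T := by
    rw [hT, ← integral_const_mul]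
    refine integral_congr_ae (Filter.Eventually.of_forall fun Y => ?_)
    dsimp only
    rw [modeAn_apply]
    ring
  rw [hrhs]
  have hcc : ((n + 1 : ℕ) : ℂ) = ((Real.sqrt (n + 1) : ℝ) : ℂ) * ((Real.sqrt (n + 1) : ℝ) : ℂ) := by
    rw [← Complex.ofReal_mul, Real.mul_self_sqrt (by positivity)]
    push_cast
    ring
  have hc1 := sqrt_cast_ne_zero n
  rw [hcc]
  field_simp

/-- The conjugate relation **`⟨a(φ)Ψ, Φ⟩ = ⟨Ψ, a†(φ)Φ⟩`** (same hypotheses).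
[cite: LSSY2005, App. A (A.13)–(A.14)] -/
theorem integral_conj_modeAn_mul (hφ : Measurable φ) {C : ℝ} (hC : ∀ x, ‖φ x‖ ≤ C)
    {Φ : Config n → ℂ} (hΦ : Continuous Φ) {Ψ : Config (n + 1) → ℂ} (hΨ : Continuous Ψ)
    (hsymm : ∀ (σ : Equiv.Perm (Fin (n + 1))) (X : Config (n + 1)), Ψ (X ∘ σ) = Ψ X) :
    ∫ Y in cellN n L, conj (modeAn L φ Ψ Y) * Φ Y =
      ∫ X in cellN (n + 1) L, conj (Ψ X) * modeCr φ Φ X := by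
  calc ∫ Y in cellN n L, conj (modeAn L φ Ψ Y) * Φ Y
      = conj (∫ Y in cellN n L, conj (Φ Y) * modeAn L φ Ψ Y) := by
        rw [← integral_conj]
        refine integral_congr_ae (Filter.Eventually.of_forall fun Y => ?_)
        simp only [map_mul, Complex.conj_conj]
        ring
    _ = conj (∫ X in cellN (n + 1) L, conj (modeCr φ Φ X) * Ψ X) := by
        rw [integral_conj_modeCr_mul hφ hC hΦ hΨ hsymm]
    _ = ∫ X in cellN (n + 1) L, conj (Ψ X) * modeCr φ Φ X := by
        rw [← integral_conj]
        refine integral_congr_ae (Filter.Eventually.of_forall fun X => ?_)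
        simp only [map_mul, Complex.conj_conj]
        ring

end Adjoint

/-! ### Dictionary (i): occupations are `‖a(φ)Ψ‖²` -/

section Occupation

variable {L : ℝ} {n : ℕ}

/-- `‖√(n+1) z‖₊² = (n+1) ‖z‖₊²` in `ℝ≥0∞`. [folklore] -/
theorem nnnorm_sqrt_mul_sq (n : ℕ) (z : ℂ) :
    ((‖((Real.sqrt (n + 1) : ℝ) : ℂ) * z‖₊ : ℝ≥0∞) ^ 2) = (n + 1 : ℝ≥0∞) * (‖z‖₊ : ℝ≥0∞) ^ 2 := by
  rw [nnnorm_mul, ENNReal.coe_mul, mul_pow, coe_nnnorm_sq_eq_ofReal, Complex.norm_real,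
    Real.norm_of_nonneg (Real.sqrt_nonneg _), Real.sq_sqrt (by positivity)]
  congr 1
  rw [show (n + 1 : ℝ) = ((n + 1 : ℕ) : ℝ) by push_cast; ring, ENNReal.ofReal_natCast]
  push_cast
  ring

/-- **The occupation of a mode is `⟨Ψ, a†(φ)a(φ)Ψ⟩ = ‖a(φ)Ψ‖²`**: for every mode `φ` of the cell and
every `(n+1)`-body `Ψ`, `cellOccupation (n+1) L φ Ψ = ∫_{Λⁿ} |(a(φ)Ψ)(Y)|² dY` (unfolding
`⟨φ, γ_Ψφ⟩ = N ∫|∫conj(φ)Ψ|²` (1.17) and (A.13); no hypotheses).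
[cite: LSSY2005, App. A (A.11), (A.13); §1.2 (1.17)] -/
theorem cellOccupation_eq_lintegral_modeAn (L : ℝ) (φ : Space → ℂ) (Ψ : Config (n + 1) → ℂ) :
    cellOccupation (n + 1) L φ Ψ = ∫⁻ Y in cellN n L, (‖modeAn L φ Ψ Y‖₊ : ℝ≥0∞) ^ 2 := by
  rw [cellOccupation_succ]
  simp only [modeAn, nnnorm_sqrt_mul_sq]
  rw [lintegral_const_mul' _ _ (by simp)]

/-- **`n_k(Ψ) = ⟨Ψ, a†_k a_k Ψ⟩ = ‖a_k Ψ‖²`** for the plane wave `φ_k`, `k ∈ ℤ³`.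
[cite: LSSY2005, App. A (A.11), (A.13)] -/
theorem momentumOccupation_eq_lintegral_modeAn (L : ℝ) (k : Momentum) (Ψ : Config (n + 1) → ℂ) :
    momentumOccupation (n + 1) L k Ψ =
      ∫⁻ Y in cellN n L, (‖modeAn L (planeWave L k) Ψ Y‖₊ : ℝ≥0∞) ^ 2 :=
  cellOccupation_eq_lintegral_modeAn L _ Ψ

/-- **`condensateOccupation = ⟨Ψ, a†_0 a_0 Ψ⟩ = ‖a_0 Ψ‖²`** (Fournais's `n₀`).
[cite: Fournais2020, (1.3)–(1.5)] -/
theorem condensateOccupation_eq_lintegral_modeAn (L : ℝ) (Ψ : Config (n + 1) → ℂ) :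
    condensateOccupation (n + 1) L Ψ =
      ∫⁻ Y in cellN n L, (‖modeAn L (planeWave L 0) Ψ Y‖₊ : ℝ≥0∞) ^ 2 := by
  rw [← momentumOccupation_zero, momentumOccupation_eq_lintegral_modeAn]

/-- The same through `constantMode L = φ_0`. [cite: Fournais2020, (1.3)–(1.5)] -/
theorem condensateOccupation_eq_lintegral_modeAn_constantMode (L : ℝ) (Ψ : Config (n + 1) → ℂ) :
    condensateOccupation (n + 1) L Ψ =
      ∫⁻ Y in cellN n L, (‖modeAn L (constantMode L) Ψ Y‖₊ : ℝ≥0∞) ^ 2 := by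
  rw [condensateOccupation_eq_lintegral_modeAn, planeWave_zero]

/-- **The number operator `Σ_k a†_k a_k`** [(A.11)]: `Σ_k ‖a_kΨ‖² = N ∫_{Λ^N}|Ψ|²` for a continuous
`N = n+1`-body `Ψ` (Parseval in the contracted particle). [cite: LSSY2005, App. A (A.11)] -/
theorem tsum_lintegral_modeAn_planeWave (hL : 0 < L) {Ψ : Config (n + 1) → ℂ} (hΨ : Continuous Ψ) :
    ∑' k, ∫⁻ Y in cellN n L, (‖modeAn L (planeWave L k) Ψ Y‖₊ : ℝ≥0∞) ^ 2 =
      (n + 1 : ℝ≥0∞) * ∫⁻ X in cellN (n + 1) L, (‖Ψ X‖₊ : ℝ≥0∞) ^ 2 := by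
  simp only [← momentumOccupation_eq_lintegral_modeAn]
  exact tsum_momentumOccupation hL hΨ

/-- **`Σ_k ⟨a†_k a_k⟩ = N`** on a periodic trial state. [cite: LSSY2005, App. A (A.11)] -/
theorem tsum_lintegral_modeAn_planeWave_trialState (hL : 0 < L) (Ψ : PeriodicTrialState (n + 1) L) :
    ∑' k, ∫⁻ Y in cellN n L, (‖modeAn L (planeWave L k) Ψ.ψ Y‖₊ : ℝ≥0∞) ^ 2 = (n + 1 : ℕ) := by
  simp only [← momentumOccupation_eq_lintegral_modeAn]
  exact tsum_momentumOccupation_trialState hL Ψ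

/-- **The depletion `⟨n₊⟩ = N - n₀ = Σ_{k≠0} ‖a_kΨ‖²`** on a periodic trial state (the route's penalty
`2ργ(N - n₀)` is the exchange shift `Δ Σ_{k≠0} a†_k a_k`). [cite: Fournais2020, (1.5)] -/
theorem natCast_sub_condensateOccupation_eq_tsum_modeAn (hL : 0 < L)
    (Ψ : PeriodicTrialState (n + 1) L) :
    ((n + 1 : ℕ) : ℝ≥0∞) - condensateOccupation (n + 1) L Ψ.ψ =
      ∑' k, if k = 0 then 0 else
        ∫⁻ Y in cellN n L, (‖modeAn L (planeWave L k) Ψ.ψ Y‖₊ : ℝ≥0∞) ^ 2 := by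
  simp only [← momentumOccupation_eq_lintegral_modeAn]
  exact natCast_sub_condensateOccupation hL Ψ

/-! ### Dictionary (iii): the kinetic energy is `Σ_k k² a†_k a_k` -/

/-- **`∫_{Λ^N} |∇Ψ|² = Σ_k |k|² ‖a_kΨ‖²`** for a periodic `C¹` Bose-symmetric `N = n+1`-body state
(Parseval for gradients on the torus, layer C). [cite: LSSY2005, App. A (A.6), (A.10)] -/
theorem lintegral_kineticDensity_eq_tsum_modeAn (hL : 0 < L) (Ψ : PeriodicTrialState (n + 1) L) :
    ∫⁻ X in cellN (n + 1) L, kineticDensity Ψ.ψ X = ∑' k, ENNReal.ofReal (‖waveVector L k‖ ^ 2) *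
      ∫⁻ Y in cellN n L, (‖modeAn L (planeWave L k) Ψ.ψ Y‖₊ : ℝ≥0∞) ^ 2 := by
  simp only [← momentumOccupation_eq_lintegral_modeAn]
  exact (tsum_normSq_waveVector_mul_momentumOccupation hL Ψ).symm

/-- **`periodicEnergy 0 Ψ = ⟨Ψ, Σ_k k² a†_k a_k Ψ⟩ = Σ_k |k|² ‖a_kΨ‖²`** — the kinetic term of
`H_R = Σ_k (k² + Δ[k≠0]) a†_k a_k + (γ/2V) P†P`. [cite: LSSY2005, App. A (A.6), (A.10)] -/
theorem periodicEnergy_zero_eq_tsum_modeAn (hL : 0 < L) (Ψ : PeriodicTrialState (n + 1) L) :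
    periodicEnergy 0 Ψ = ∑' k, ENNReal.ofReal (‖waveVector L k‖ ^ 2) *
      ∫⁻ Y in cellN n L, (‖modeAn L (planeWave L k) Ψ.ψ Y‖₊ : ℝ≥0∞) ^ 2 := by
  simp only [← momentumOccupation_eq_lintegral_modeAn]
  exact periodicEnergy_zero_eq_tsum hL Ψ

end Occupation

/-! ### Dictionary (ii): `P_B = Σ_{k∈B} a_{-k}a_k` and the route's pair functional -/

section PairOperator

variable {L : ℝ} {n : ℕ}

/-- **`P_B = Σ_{k∈B} a_{-k} a_k` in first quantisation**: for a continuous `(n+2)`-body `Ψ` and any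
finite set `B` of momenta, `bandPairAnnihilation L B Ψ = Σ_{k∈B} a(φ_{-k})(a(φ_k)Ψ)` (the kernel
`Σ_k conj(φ_k(x)φ_{-k}(y))` of `TorusBoseFockLayer.bandPairAnnihilation` is `Σ_k` of two successive
contractions (A.13); Fubini on `cell × cell`). [cite: LSSY2005, App. A (A.13)] -/
theorem bandPairAnnihilation_eq_sum_modeAn (L : ℝ) (B : Finset Momentum) {Ψ : Config (n + 2) → ℂ}
    (hΨ : Continuous Ψ) :
    bandPairAnnihilation L B Ψ =
      ∑ k ∈ B, modeAn L (planeWave L (-k)) (modeAn L (planeWave L k) Ψ) := by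
  funext Y
  rw [Finset.sum_apply]
  simp only [modeAn_modeAn_apply]
  rw [bandPairAnnihilation, ← Finset.mul_sum]
  congr 1
  -- the integrands, term by term
  set F : Momentum → Space → Space → ℂ := fun k x y =>
    conj (planeWave L k x) * (conj (planeWave L (-k) y) * Ψ (Matrix.vecCons x (Matrix.vecCons y Y)))
    with hF
  have hb : ∀ k x, ‖planeWave L k x‖ ≤ |(Real.sqrt (L ^ 3))⁻¹| := norm_planeWave_le L
  -- joint integrability on `cell × cell`
  have hint : ∀ k, Integrable (Function.uncurry (F k))
      (((volume : Measure Space).restrict (cell L)).prod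
        ((volume : Measure Space).restrict (cell L))) := by
    intro k
    refine (integrable_cell_prod_cell (L := L) (measurable_planeWave L (-k)) (measurable_planeWave L k)
      (hb (-k)) (hb k) hΨ Y).congr (Filter.Eventually.of_forall fun p => ?_)
    simp only [hF, Function.uncurry]
    ring
  -- integrability of the inner integrands for every fixed `x`
  have hinner : ∀ k x, Integrable (F k x) ((volume : Measure Space).restrict (cell L)) := by
    intro k x
    have hc : Continuous fun y : Space => Ψ (Matrix.vecCons x (Matrix.vecCons y Y)) :=
      hΨ.comp (continuous_const.matrixVecCons (continuous_id.matrixVecCons continuous_const))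
    exact (integrableOn_cell_conj_mul (measurable_planeWave L (-k)) (hb (-k)) hc).const_mul _
  calc ∫ x in cell L, ∫ y in cell L,
        conj (∑ k ∈ B, planeWave L k x * planeWave L (-k) y) * Ψ (Matrix.vecCons x (Matrix.vecCons y Y))
      = ∫ x in cell L, ∫ y in cell L, ∑ k ∈ B, F k x y := by
        refine integral_congr_ae (Filter.Eventually.of_forall fun x => ?_)
        refine integral_congr_ae (Filter.Eventually.of_forall fun y => ?_)
        simp only [hF, map_sum, Finset.sum_mul, map_mul]
        exact Finset.sum_congr rfl fun k _ => by ring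
    _ = ∫ x in cell L, ∑ k ∈ B, ∫ y in cell L, F k x y := by
        refine integral_congr_ae (Filter.Eventually.of_forall fun x => ?_)
        exact integral_finsetSum _ fun k _ => hinner k x
    _ = ∑ k ∈ B, ∫ x in cell L, ∫ y in cell L, F k x y :=
        integral_finsetSum _ fun k _ => (hint k).integral_prod_left
    _ = ∑ k ∈ B, ∫ y in cell L, ∫ x in cell L, conj (planeWave L (-k) y) * conj (planeWave L k x) *
          Ψ (Matrix.vecCons x (Matrix.vecCons y Y)) := by
        refine Finset.sum_congr rfl fun k _ => ?_
        rw [integral_integral_swap (hint k)]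
        refine integral_congr_ae (Filter.Eventually.of_forall fun y => ?_)
        refine integral_congr_ae (Filter.Eventually.of_forall fun x => ?_)
        simp only [hF]
        ring

/-- **`⟨Ψ, P†_B P_B Ψ⟩ = ‖P_{B_M}Ψ‖² = N(N-1) L⁻⁶ ∫_{Λ^{N-2}} |∫_Λ∫_Λ conj(w(x,y)) Ψ(x,y,Y) dx dy|² dY`**
for the band `B_M = {-M..M}³` and its kernel `w = bandKernel L M` (verbatim the route's `w_Λ`,
`bandKernel_eq`), `N = n+2`, every `Ψ` (rearrangement of `pairFunctional_eq`). Hence the route's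
interaction `(γ/L⁹)(N(N-1)/2) ∫|∫∫conj(w)Ψ|² = (γ/2L³) ‖P_{B_M}Ψ‖²`, the quartic term
`(g/2) Σ A†A` of the pairing Hamiltonian with `g = γ/V`.
[cite: LSSY2005, App. A (A.10), (A.13); DukelskySchuck2001, (1)] -/
theorem lintegral_bandPairAnnihilation_sq (hL : 0 < L) (M : ℕ) (Ψ : Config (n + 2) → ℂ) :
    ∫⁻ Y in cellN n L, (‖bandPairAnnihilation L (momentumBand M) Ψ Y‖₊ : ℝ≥0∞) ^ 2 =
      ENNReal.ofReal (((n + 2 : ℕ) : ℝ) * ((n + 2 : ℕ) - 1) / L ^ 6) *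
        ∫⁻ Y in cellN n L, (‖∫ x in cell L, ∫ y in cell L,
          conj (bandKernel L M x y) * Ψ (Matrix.vecCons x (Matrix.vecCons y Y))‖₊ : ℝ≥0∞) ^ 2 := by
  have hL6 : 0 < L ^ 6 := by positivity
  have h := pairFunctional_eq hL M Ψ
  have h2 : ENNReal.ofReal (2 / L ^ 6) * ENNReal.ofReal (L ^ 6 / 2) = 1 := by
    rw [← ENNReal.ofReal_mul (by positivity), ← ENNReal.ofReal_one]
    congr 1; field_simp
  calc ∫⁻ Y in cellN n L, (‖bandPairAnnihilation L (momentumBand M) Ψ Y‖₊ : ℝ≥0∞) ^ 2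
      = ENNReal.ofReal (2 / L ^ 6) * (ENNReal.ofReal (L ^ 6 / 2) *
          ∫⁻ Y in cellN n L, (‖bandPairAnnihilation L (momentumBand M) Ψ Y‖₊ : ℝ≥0∞) ^ 2) := by
        rw [← mul_assoc, h2, one_mul]
    _ = _ := by
        rw [← h, ← mul_assoc, ← ENNReal.ofReal_mul (by positivity)]
        congr 2
        field_simp

/-- The same with `P_{B_M}` written as `Σ_{k∈B_M} a_{-k}a_k` (continuous `Ψ`):
`‖Σ_{k∈B_M} a_{-k}a_kΨ‖² = N(N-1) L⁻⁶ ∫_{Λ^{N-2}} |∫∫ conj(w) Ψ|²` — literally the dictionary lemma (ii)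
of the route's request. [cite: LSSY2005, App. A (A.10), (A.13); DukelskySchuck2001, (1)] -/
theorem lintegral_sum_modeAn_modeAn_sq (hL : 0 < L) (M : ℕ) {Ψ : Config (n + 2) → ℂ}
    (hΨ : Continuous Ψ) :
    ∫⁻ Y in cellN n L, (‖∑ k ∈ momentumBand M,
        modeAn L (planeWave L (-k)) (modeAn L (planeWave L k) Ψ) Y‖₊ : ℝ≥0∞) ^ 2 =
      ENNReal.ofReal (((n + 2 : ℕ) : ℝ) * ((n + 2 : ℕ) - 1) / L ^ 6) *
        ∫⁻ Y in cellN n L, (‖∫ x in cell L, ∫ y in cell L,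
          conj (bandKernel L M x y) * Ψ (Matrix.vecCons x (Matrix.vecCons y Y))‖₊ : ℝ≥0∞) ^ 2 := by
  have h' : ∀ Y, (∑ k ∈ momentumBand M, modeAn L (planeWave L (-k)) (modeAn L (planeWave L k) Ψ) Y) =
      bandPairAnnihilation L (momentumBand M) Ψ Y := fun Y => by
    rw [bandPairAnnihilation_eq_sum_modeAn L (momentumBand M) hΨ, Finset.sum_apply]
  simp only [h']
  exact lintegral_bandPairAnnihilation_sq hL M Ψ

end PairOperator

/-! ### The configuration-space Fock layer of the torus -/

/-- **The Fock layer of the torus in configuration space**: a Fock vector is its sequence of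
`n`-body amplitudes `Ψ = (Ψ⁽ⁿ⁾)_{n ≥ 0}`, `Ψ⁽ⁿ⁾ : (ℝ³)ⁿ → ℂ` (read on the fundamental cell `Λⁿ = [0,L)^{3n}`
in all integrals) — `𝓕(Λ_L) = ⊕_{n≥0} L²(Λ_Lⁿ)` as an algebraic direct product (square-summability,
`normSq L Ψ < ∞`, and Bose symmetry of the components are stated where needed, as for
`PeriodicTrialState`). On it the mode operators act degree-wise (`an`, `cr`), `number` is
`(𝒩Ψ)⁽ⁿ⁾ = nΨ⁽ⁿ⁾`, `vacuum = (1,0,0,…)`, and an `N`-body wave function is the vector `ofSector N Ψ`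
concentrated in degree `N`; this is the first-quantised side of the isomorphism (A.9), the abstract
(polynomial) side being `TorusBoseFockLayer`.
[cite: BastiCenatiempoSchlein2021, §1 (𝓕(Λ_L) = ⊕ L²_s(Λ_Lⁿ), (𝒩ψ)⁽ⁿ⁾ = nψ⁽ⁿ⁾); LSSY2005, App. A (A.9)] -/
abbrev TorusFockLayer : Type := (n : ℕ) → Config n → ℂ

namespace TorusFockLayer

variable {L : ℝ}

/-- Annihilation of the mode `φ`, degree-wise: `(a(φ)Ψ)⁽ⁿ⁾ = a(φ)Ψ⁽ⁿ⁺¹⁾` (A.13).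
[cite: LSSY2005, App. A (A.13)] -/
def an (L : ℝ) (φ : Space → ℂ) (Ψ : TorusFockLayer) : TorusFockLayer :=
  fun n => modeAn L φ (Ψ (n + 1))

/-- Creation of the mode `φ`, degree-wise: `(a†(φ)Ψ)⁽⁰⁾ = 0`, `(a†(φ)Ψ)⁽ⁿ⁺¹⁾ = a†(φ)Ψ⁽ⁿ⁾` (A.14).
[cite: LSSY2005, App. A (A.14)] -/
def cr (φ : Space → ℂ) (Ψ : TorusFockLayer) : TorusFockLayer
  | 0 => 0
  | n + 1 => modeCr φ (Ψ n)

/-- The vacuum `|0⟩ = (1, 0, 0, …)`. [cite: LSSY2005, App. A (A.8)] -/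
def vacuum : TorusFockLayer := Pi.single 0 fun _ => 1

/-- An `N`-body wave function as the Fock vector concentrated in degree `N`.
[cite: BastiCenatiempoSchlein2021, §1] -/
def ofSector (N : ℕ) (Ψ : Config N → ℂ) : TorusFockLayer := Pi.single N Ψ

/-- The number operator `(𝒩Ψ)⁽ⁿ⁾ = nΨ⁽ⁿ⁾`. [cite: BastiCenatiempoSchlein2021, §1] -/
def number (Ψ : TorusFockLayer) : TorusFockLayer := fun n => (n : ℂ) • Ψ n

/-- The Fock norm `‖Ψ‖² = Σ_n ∫_{Λⁿ} |Ψ⁽ⁿ⁾|²` (in `ℝ≥0∞`). [cite: BastiCenatiempoSchlein2021, §1] -/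
def normSq (L : ℝ) (Ψ : TorusFockLayer) : ℝ≥0∞ :=
  ∑' n, ∫⁻ X in cellN n L, (‖Ψ n X‖₊ : ℝ≥0∞) ^ 2

/-- Unfolding `an`. [cite: LSSY2005, App. A (A.13)] -/
theorem an_apply (L : ℝ) (φ : Space → ℂ) (Ψ : TorusFockLayer) (n : ℕ) :
    an L φ Ψ n = modeAn L φ (Ψ (n + 1)) := rfl

/-- `(a†(φ)Ψ)⁽⁰⁾ = 0`. [cite: LSSY2005, App. A (A.14)] -/
@[simp] theorem cr_apply_zero (φ : Space → ℂ) (Ψ : TorusFockLayer) : cr φ Ψ 0 = 0 := rfl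

/-- `(a†(φ)Ψ)⁽ⁿ⁺¹⁾ = a†(φ)Ψ⁽ⁿ⁾`. [cite: LSSY2005, App. A (A.14)] -/
theorem cr_apply_succ (φ : Space → ℂ) (Ψ : TorusFockLayer) (n : ℕ) :
    cr φ Ψ (n + 1) = modeCr φ (Ψ n) := rfl

/-- Unfolding `number`. [cite: BastiCenatiempoSchlein2021, §1] -/
theorem number_apply (Ψ : TorusFockLayer) (n : ℕ) : number Ψ n = (n : ℂ) • Ψ n := rfl

/-- `|0⟩⁽⁰⁾ = 1`. [cite: LSSY2005, App. A (A.8)] -/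
@[simp] theorem vacuum_zero : vacuum 0 = fun _ => 1 := by
  simp [vacuum]

/-- `|0⟩⁽ⁿ⁺¹⁾ = 0`. [cite: LSSY2005, App. A (A.8)] -/
theorem vacuum_succ (n : ℕ) : vacuum (n + 1) = 0 := by
  simp [vacuum]

/-- The degree-`N` component of `ofSector N Ψ` is `Ψ`. [folklore] -/
@[simp] theorem ofSector_self (N : ℕ) (Ψ : Config N → ℂ) : ofSector N Ψ N = Ψ := by
  simp [ofSector]

/-- The other components of `ofSector N Ψ` vanish. [folklore] -/
theorem ofSector_of_ne {N n : ℕ} (h : n ≠ N) (Ψ : Config N → ℂ) : ofSector N Ψ n = 0 := by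
  simp [ofSector, h]

/-- **`a(φ)|0⟩ = 0`** for every mode. [cite: LSSY2005, App. A (A.8)] -/
@[simp] theorem an_vacuum (L : ℝ) (φ : Space → ℂ) : an L φ vacuum = 0 := by
  funext n
  rw [an_apply, vacuum_succ, modeAn_zero]
  rfl

/-- `𝒩|0⟩ = 0`. [cite: LSSY2005, App. A (A.8), (A.11)] -/
@[simp] theorem number_vacuum : number vacuum = 0 := by
  funext n
  cases n with
  | zero => simp [number_apply]
  | succ n => simp [number_apply, vacuum_succ]

/-- **`𝒩Ψ = NΨ` on an `N`-body state** ((A.11): "when acting on `Ψ` yield `N`").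
[cite: LSSY2005, App. A (A.11)] -/
theorem number_ofSector (N : ℕ) (Ψ : Config N → ℂ) :
    number (ofSector N Ψ) = (N : ℂ) • ofSector N Ψ := by
  funext n
  by_cases h : n = N
  · subst h; simp [number_apply]
  · simp [number_apply, ofSector_of_ne h]

/-- `a(φ)` lowers the particle number: on an `(N+1)`-body state it is `a(φ)` of the sector
("this state has particle number `N-1`"). [cite: LSSY2005, App. A (A.13)] -/
theorem an_ofSector_succ (L : ℝ) (φ : Space → ℂ) (N : ℕ) (Ψ : Config (N + 1) → ℂ) :
    an L φ (ofSector (N + 1) Ψ) = ofSector N (modeAn L φ Ψ) := by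
  funext n
  rw [an_apply]
  by_cases h : n = N
  · subst h; simp
  · rw [ofSector_of_ne h, ofSector_of_ne (by omega), modeAn_zero]

/-- `a(φ)` annihilates `0`-body states. [cite: LSSY2005, App. A (A.8)] -/
theorem an_ofSector_zero (L : ℝ) (φ : Space → ℂ) (Ψ : Config 0 → ℂ) : an L φ (ofSector 0 Ψ) = 0 := by
  funext n
  rw [an_apply, ofSector_of_ne (by omega), modeAn_zero]
  rfl

/-- `a†(φ)` raises the particle number: on an `N`-body state it is `a†(φ)` of the sector
("the state `a†_kΨ` has `N+1` particles"). [cite: LSSY2005, App. A (A.14)] -/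
theorem cr_ofSector (φ : Space → ℂ) (N : ℕ) (Φ : Config N → ℂ) :
    cr φ (ofSector N Φ) = ofSector (N + 1) (modeCr φ Φ) := by
  funext n
  cases n with
  | zero => rw [cr_apply_zero, ofSector_of_ne (by omega)]
  | succ n =>
    rw [cr_apply_succ]
    by_cases h : n = N
    · subst h; simp
    · rw [ofSector_of_ne h, ofSector_of_ne (by omega), modeCr_zero]

/-- The Fock norm of an `N`-body state is its `L²(Λ^N)` norm. [cite: BastiCenatiempoSchlein2021, §1] -/
theorem normSq_ofSector (L : ℝ) (N : ℕ) (Ψ : Config N → ℂ) :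
    normSq L (ofSector N Ψ) = ∫⁻ X in cellN N L, (‖Ψ X‖₊ : ℝ≥0∞) ^ 2 := by
  rw [normSq, tsum_eq_single N]
  · rw [ofSector_self]
  · intro n hn
    simp [ofSector_of_ne hn]

/-- A periodic trial state is a unit Fock vector. [cite: Fournais2020, (1.1)–(1.2)] -/
theorem normSq_ofSector_trialState {N : ℕ} (Ψ : PeriodicTrialState N L) :
    normSq L (ofSector N Ψ.ψ) = 1 := by
  rw [normSq_ofSector, Ψ.norm_eq]

/-- **CCR `a(φ)a†(ψ) = ⟨φ,ψ⟩ + a†(ψ)a(φ)`** [(A.7)] on the configuration-space Fock layer, exactly,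
for every Fock vector whose first-slot slices are integrable against `conj φ` on the cell (degree `0`:
`modeAn_modeCr_config_zero`; degree `≥ 1`: `modeAn_modeCr_apply`). [cite: LSSY2005, App. A (A.7)] -/
theorem an_cr (φ ψ : Space → ℂ) (Ψ : TorusFockLayer)
    (hφψ : IntegrableOn (fun x => conj (φ x) * ψ x) (cell L))
    (hΨ : ∀ (n : ℕ) (Z : Config n),
      IntegrableOn (fun x => conj (φ x) * Ψ (n + 1) (Matrix.vecCons x Z)) (cell L)) :
    an L φ (cr ψ Ψ) = (∫ x in cell L, conj (φ x) * ψ x) • Ψ + cr ψ (an L φ Ψ) := by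
  funext n Y
  rw [an_apply, Pi.add_apply, Pi.add_apply, Pi.smul_apply, Pi.smul_apply, smul_eq_mul]
  cases n with
  | zero =>
    rw [cr_apply_succ, cr_apply_zero, modeAn_modeCr_config_zero, Pi.zero_apply, add_zero]
  | succ m =>
    rw [cr_apply_succ, cr_apply_succ, modeAn_modeCr_apply hφψ (hΨ m) Y, an_apply]

/-- **`[a(φ), a(ψ)] = 0`** [(A.7)] on Fock vectors with continuous Bose-symmetric components, for
bounded measurable modes. [cite: LSSY2005, App. A (A.7)] -/
theorem an_an_comm {φ ψ : Space → ℂ} (hφ : Measurable φ) (hψ : Measurable ψ) {Cφ Cψ : ℝ}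
    (hCφ : ∀ x, ‖φ x‖ ≤ Cφ) (hCψ : ∀ x, ‖ψ x‖ ≤ Cψ) (Ψ : TorusFockLayer) (hc : ∀ n, Continuous (Ψ n))
    (hsymm : ∀ (n : ℕ) (σ : Equiv.Perm (Fin n)) (X : Config n), Ψ n (X ∘ σ) = Ψ n X) :
    an L φ (an L ψ Ψ) = an L ψ (an L φ Ψ) := by
  funext n
  simp only [an_apply]
  exact modeAn_modeAn_comm (L := L) hφ hψ hCφ hCψ (hc (n + 2)) (hsymm (n + 2))

/-- **The occupation of `φ` in an `N`-body state is `‖a(φ) ofSector N Ψ‖²`** (dictionary (i) on the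
Fock layer; for `N = 0` both sides vanish). [cite: LSSY2005, App. A (A.11), (A.13); §1.2 (1.17)] -/
theorem normSq_an_ofSector (L : ℝ) (φ : Space → ℂ) (N : ℕ) (Ψ : Config N → ℂ) :
    normSq L (an L φ (ofSector N Ψ)) = cellOccupation N L φ Ψ := by
  cases N with
  | zero =>
    rw [an_ofSector_zero, cellOccupation, occupation]
    simp [normSq]
  | succ n =>
    rw [an_ofSector_succ, normSq_ofSector, cellOccupation_eq_lintegral_modeAn]

end TorusFockLayer

end Literature.MathematicalPhysics.QuantumManyBody.BoseGas

end
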